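import Summits.CriticalPhenomena.PercolationContinuityZ3.Theorems.Transplant.SiteVdBHKRestrict
import HarnessLib

/-!
# SITE percolation restricted to `U`: clusters of a source SET, the world left after exploring them, and BHK's identity (6)
# for world functionals (WP0/WP3/WP4 infrastructure of the site CSH re-typing, P1-SITE-Z3 §12)
# (lane `prim-bschramm`, class C1a; site twin of `CovTau.sC / rest / sC_restrict / rest_restrict / setStep_sum`)

builds on p205010 (kernel theorem, internal audit signed; external expert review pending).

Bond (`CovTauA2Defs/A2Star`): `C_N` = vertices joined to the source set `N` inside `U` (every `z ∈ N` belongs to it), the world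
`rest U N ω = U ∖ C_N`, and the star decomposition at `Z ⊆ N` (condition on the open edges at `Z`).  SITE (convention A; the
census-validated world convention of `SiteWorldDefs`, p211418): `setC Γ U N ω = ⋃_{z ∈ N} C^U_z(ω)` (a CLOSED source has empty
cluster), the world `srest Γ U N ω = U ∖ (N ∪ C_N ∪ ∂_U C_N)` — the source set, its clusters AND their vertex boundary are dead —
and the star decomposition at `Z ⊆ N` conditions on the STATES of the vertices of `Z` (`SiteBHK.sS`, `blockFubini` with block `Z`):
* `setC_restrict`:  `C^U_N(ω) = (ω ∩ Z) ∪ C^{U∖Z}_{(N∖Z) ∪ S(ω)}(ω)`;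
* (`SiteBHK.mem_sD_iff_restrict`, p207743: `{x ↮ N in U} = {x ↮ (N∖Z) ∪ S(ω) in U∖Z}` for `x ∉ Z`);
* `srest_restrict`: `srest U N ω = srest (U∖Z) ((N∖Z) ∪ S(ω)) ω`;
* `setStep_sum`: `E[G(srest U N) ; x ↮ N] = Σ_ω weight(ω) E'[G(srest (U∖Z) ((N∖Z)∪S(ω))) ; x ↮ (N∖Z)∪S(ω)]`.
Support file (`--supports stmt-CriticalPhenomena-4575 --as helper`); definitions `setC`, `srest`; no named facts, no sorries.
[cite: VandenbergHaggstromKahn2005, §1 pp. 3–4, identity (6)]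
-/

noncomputable section

namespace Summit.CriticalPhenomena.PercolationContinuityZ3.Theorems.Transplant

namespace SiteBHK

open Literature.Probability.Percolation
open Literature.Probability.Percolation.BHK2006 (weight weight_nonneg blockFubini)
open scoped Classical
open DecisionTree (ind ind_of_mem ind_of_not_mem ind_nonneg)

variable {V : Type*} (Γ : SimpleGraph V)

/-! ### Clusters of a source set and the world they leave -/

/-- **The site cluster of the source SET `N` inside `U`**: the union of the site clusters `C^U_z`, `z ∈ N` (a closed source
contributes nothing). [cite: VandenbergHaggstromKahn2005, §1 p. 3] -/
def setC (U : Finset V) (N : Set V) (ω : Set V) : Set V := {u | ∃ z ∈ N, u ∈ sC Γ U z ω}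

/-- **The site world left after exploring `C_N` inside `U`**: the vertices of `U` outside the source set, outside its clusters
and NOT adjacent to them (the vertex boundary of an explored site cluster is revealed closed).
[cite: VandenbergHaggstromKahn2005, §1 p. 4 (the induced model on the rest)] -/
def srest (U : Finset V) (N : Set V) (ω : Set V) : Finset V :=
  U.filter fun u => u ∉ N ∧ u ∉ setC Γ U N ω ∧ ∀ c ∈ setC Γ U N ω, ¬ Γ.Adj u c

variable {Γ}

/-- Unfolding of membership in the set cluster. [folklore] -/
theorem mem_setC {U : Finset V} {N : Set V} {ω : Set V} {u : V} :
    u ∈ setC Γ U N ω ↔ ∃ z ∈ N, u ∈ sC Γ U z ω := Iff.rfl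

/-- Membership in the world. [folklore] -/
theorem mem_srest {U : Finset V} {N : Set V} {ω : Set V} {u : V} :
    u ∈ srest Γ U N ω ↔ u ∈ U ∧ u ∉ N ∧ u ∉ setC Γ U N ω ∧ ∀ c ∈ setC Γ U N ω, ¬ Γ.Adj u c := by
  unfold srest; rw [Finset.mem_filter]

/-- The world lies inside `U`. [folklore] -/
theorem srest_subset (U : Finset V) (N : Set V) (ω : Set V) : srest Γ U N ω ⊆ U := Finset.filter_subset _ _

/-- The set cluster consists of open vertices of `U`. [folklore] -/
theorem setC_subset (U : Finset V) (N : Set V) (ω : Set V) : setC Γ U N ω ⊆ ω ∩ ↑U :=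
  fun _ ⟨_, _, hu⟩ => hu.2.1

/-- The set cluster is monotone in the source set. [folklore] -/
theorem setC_mono_set (U : Finset V) {N N' : Set V} (h : N ⊆ N') (ω : Set V) : setC Γ U N ω ⊆ setC Γ U N' ω :=
  fun _ ⟨z, hz, hu⟩ => ⟨z, h hz, hu⟩

/-- The set cluster is monotone in the configuration. [folklore] -/
theorem setC_mono (U : Finset V) (N : Set V) {ω ω' : Set V} (h : ω ⊆ ω') : setC Γ U N ω ⊆ setC Γ U N ω' :=
  fun _ ⟨z, hz, hu⟩ => ⟨z, hz, sC_mono U z h hu⟩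

/-- The set cluster grows with `U`. [folklore] -/
theorem setC_mono_U {U U' : Finset V} (h : U' ⊆ U) (N : Set V) (ω : Set V) : setC Γ U' N ω ⊆ setC Γ U N ω :=
  fun _ ⟨z, hz, hu⟩ => ⟨z, hz, sC_mono_set h z ω hu⟩

/-- The cluster of the empty source set is empty. [folklore] -/
theorem setC_empty (U : Finset V) (ω : Set V) : setC Γ U (∅ : Set V) ω = ∅ :=
  Set.eq_empty_of_forall_notMem fun _ ⟨_, hz, _⟩ => hz

/-- The world of the empty source set is all of `U`. [folklore] -/
theorem srest_empty (U : Finset V) (ω : Set V) : srest Γ U (∅ : Set V) ω = U := by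
  ext u
  simp [mem_srest, setC_empty]

/-- Site clusters are symmetric: `u ∈ C_z ↔ z ∈ C_u`. [folklore] -/
theorem mem_sC_comm {U : Finset V} {ω : Set V} {z u : V} : u ∈ sC Γ U z ω ↔ z ∈ sC Γ U u ω := by
  constructor
  · rintro ⟨hz, hu, hr⟩; exact ⟨hu, hz, hr.symm⟩
  · rintro ⟨hu, hz, hr⟩; exact ⟨hz, hu, hr.symm⟩

/-- `x ∉ C_N` iff `x ↮ N` (the avoidance event `sD Γ U x N`). [folklore] -/
theorem not_mem_setC_iff (U : Finset V) (N : Set V) (ω : Set V) (x : V) :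
    x ∉ setC Γ U N ω ↔ ω ∈ sD Γ U x N := by
  simp only [mem_setC, not_exists, not_and, sD, Set.mem_setOf_eq]
  exact forall₂_congr fun z _ => by rw [mem_sC_comm]

/-- The set cluster inside `U ∖ Z` does not depend on the states on `Z`. [folklore] -/
theorem setC_diff (U Z : Finset V) (N : Set V) (ω : Set V) : setC Γ (U \ Z) N (ω \ ↑Z) = setC Γ (U \ Z) N ω := by
  simp only [setC, sC_diff]

/-- The world inside `U ∖ Z` does not depend on the states on `Z`. [folklore] -/
theorem srest_diff (U Z : Finset V) (N : Set V) (ω : Set V) : srest Γ (U \ Z) N (ω \ ↑Z) = srest Γ (U \ Z) N ω := by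
  ext u; rw [mem_srest, mem_srest, setC_diff]

/-! ### BHK's identity (6), site form, for a source set -/

/-- **Site (6) for a source SET, pointwise**: for `Z ⊆ U`, `Z ⊆ N`,
`C^U_N(ω) = (ω ∩ Z) ∪ C^{U∖Z}_{(N∖Z) ∪ S(ω)}(ω)` — a path from a source that meets `Z` leaves it for the last time at an OPEN
vertex of `Z` through a neighbour in `U ∖ Z`, which is a source of `S(ω)`. [cite: VandenbergHaggstromKahn2005, §1 p. 4, identity (6)] -/
theorem setC_restrict {U Z : Finset V} (hZU : Z ⊆ U) {N : Set V} (hZN : (↑Z : Set V) ⊆ N) (ω : Set V) :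
    setC Γ U N ω = (ω ∩ ↑Z) ∪ setC Γ (U \ Z) ((N \ ↑Z) ∪ sS Γ U Z ω) ω := by
  ext u
  constructor
  · rintro ⟨z, hzN, ⟨hzo, hzU⟩, ⟨huo, huU⟩, hr⟩
    have hzU : z ∈ U := hzU
    have huU : u ∈ U := huU
    -- along the path: either the current vertex is an open vertex of `Z`, or it lies in the cluster of a source of
    -- `(N ∖ Z) ∪ S(ω)` inside `U ∖ Z`
    rw [SimpleGraph.reachable_iff_reflTransGen] at hr
    suffices h : ∀ c, Relation.ReflTransGen (siteOpenGraph Γ (ω ∩ ↑U)).Adj z c → c ∈ ω → c ∈ U →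
        c ∈ (ω ∩ ↑Z) ∪ setC Γ (U \ Z) ((N \ ↑Z) ∪ sS Γ U Z ω) ω from h u hr huo huU
    intro c hc
    induction hc with
    | refl =>
      intro hco hcU
      by_cases hcZ : z ∈ Z
      · exact Or.inl ⟨hco, hcZ⟩
      · have hz' : z ∈ ω ∩ (↑(U \ Z) : Set V) := ⟨hco, by simpa using And.intro hcU hcZ⟩
        exact Or.inr ⟨z, Or.inl ⟨hzN, hcZ⟩, hz', hz', SimpleGraph.Reachable.refl z⟩
    | @tail b c _ hbc ih =>
      intro hco hcU
      obtain ⟨hadj, ⟨hbo, hbU⟩, -⟩ := adj_iff.1 hbc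
      have hbU : b ∈ U := hbU
      by_cases hcZ : c ∈ Z
      · exact Or.inl ⟨hco, hcZ⟩
      have hc' : c ∈ ω ∩ (↑(U \ Z) : Set V) := ⟨hco, by simpa using And.intro hcU hcZ⟩
      rcases ih hbo hbU with ⟨_, hbZ⟩ | ⟨m, hm, hbm⟩
      · -- `b` is an open vertex of `Z`: `c` is a source of `S(ω)`
        have hcS : c ∈ sS Γ U Z ω := ⟨Finset.mem_sdiff.2 ⟨hcU, hcZ⟩, b, hbZ, hbo, hadj.symm⟩
        exact Or.inr ⟨c, Or.inr hcS, hc', hc', SimpleGraph.Reachable.refl c⟩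
      · -- `b` lies in the cluster of the source `m` inside `U ∖ Z`; so does `c`
        obtain ⟨hm', hb', hr'⟩ := hbm
        have hbZ : b ∉ Z := fun hbZ => by
          have := hb'.2; rw [Finset.coe_sdiff] at this; exact this.2 hbZ
        refine Or.inr ⟨m, hm, hm', hc', hr'.trans (SimpleGraph.Adj.reachable ?_)⟩
        exact adj_iff.2 ⟨hadj, ⟨hbo, Finset.mem_sdiff.2 ⟨hbU, hbZ⟩⟩, ⟨hco, Finset.mem_sdiff.2 ⟨hcU, hcZ⟩⟩⟩
  · rintro (⟨huo, huZ⟩ | ⟨m, hm, hum⟩)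
    · have huZ : u ∈ Z := huZ
      exact ⟨u, hZN huZ, ⟨huo, hZU huZ⟩, ⟨huo, hZU huZ⟩, SimpleGraph.Reachable.refl u⟩
    · rcases hm with ⟨hmN, -⟩ | ⟨_, z, hzZ, hzo, hmz⟩
      · exact ⟨m, hmN, sC_mono_set Finset.sdiff_subset m ω hum⟩
      · -- `m ∈ S(ω)`: `m` is joined to the open vertex `z ∈ Z ⊆ N`
        have hum' := sC_mono_set (Finset.sdiff_subset (t := Z)) m ω hum
        obtain ⟨⟨hmo, hmU⟩, hu', hr⟩ := hum'
        refine ⟨z, hZN hzZ, ⟨hzo, hZU hzZ⟩, hu', (SimpleGraph.Adj.reachable (adj_iff.2 ?_)).trans hr⟩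
        exact ⟨hmz.symm, ⟨hzo, hZU hzZ⟩, ⟨hmo, hmU⟩⟩

/-- **The world restricts**: `srest U N ω = srest (U ∖ Z) ((N ∖ Z) ∪ S(ω)) ω` for `Z ⊆ U`, `Z ⊆ N` (the vertices of `U ∖ Z` adjacent to
the open part of `Z` are sources of `S(ω)`, hence dead on both sides; those adjacent to the rest of `C_N` are boundary vertices on both
sides). [cite: VandenbergHaggstromKahn2005, §1 p. 4, identity (6)] -/
theorem srest_restrict {U Z : Finset V} (hZU : Z ⊆ U) {N : Set V} (hZN : (↑Z : Set V) ⊆ N) (ω : Set V) :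
    srest Γ U N ω = srest Γ (U \ Z) ((N \ ↑Z) ∪ sS Γ U Z ω) ω := by
  ext u
  rw [mem_srest, mem_srest, setC_restrict hZU hZN ω]
  set C' := setC Γ (U \ Z) ((N \ ↑Z) ∪ sS Γ U Z ω) ω with hC'
  constructor
  · rintro ⟨huU, huN, huC, hadjC⟩
    have huZ : u ∉ Z := fun h => huN (hZN h)
    refine ⟨Finset.mem_sdiff.2 ⟨huU, huZ⟩, ?_, fun h => huC (Or.inr h), fun c hc => hadjC c (Or.inr hc)⟩
    rintro (⟨huN', -⟩ | ⟨-, z, hzZ, hzo, huz⟩)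
    · exact huN huN'
    · exact hadjC z (Or.inl ⟨hzo, hzZ⟩) huz
  · rintro ⟨huUZ, huM, huC, hadjC⟩
    obtain ⟨huU, huZ⟩ := Finset.mem_sdiff.1 huUZ
    refine ⟨huU, fun huN => huM (Or.inl ⟨huN, huZ⟩), ?_, ?_⟩
    · rintro (⟨_, huZ'⟩ | h)
      · exact huZ huZ'
      · exact huC h
    · rintro c (⟨hco, hcZ⟩ | hc) huc
      · exact huM (Or.inr ⟨huUZ, c, hcZ, hco, huc⟩)
      · exact hadjC c hc huc

variable [Fintype V]

/-- **Site (6) for world functionals, summed** (site twin of `CovTau.setStep_sum`): for `Z ⊆ U`, `Z ⊆ N`, `x ∉ Z` and any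
`G : Finset V → ℝ`, `E[G(srest U N) ; x ↮ N] = Σ_ω weight(ω) · E'[G(srest (U∖Z) ((N∖Z) ∪ S(ω))) ; x ↮ (N∖Z) ∪ S(ω)]`, primes denoting fresh
states (only those off `Z` matter). [cite: VandenbergHaggstromKahn2005, §1 p. 4, identity (6)] -/
theorem setStep_sum {U Z : Finset V} (hZU : Z ⊆ U) {x : V} (hx : x ∉ Z) {N : Set V}
    (hZN : (↑Z : Set V) ⊆ N) (q : V → ℝ) (hm : ∑ ω, weight q ω = 1) (G : Finset V → ℝ) :
    ∑ ω, weight q ω * (G (srest Γ U N ω) * ind (sD Γ U x N) ω) =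
      ∑ ω, weight q ω * ∑ ω', weight q ω' *
        (G (srest Γ (U \ Z) ((N \ ↑Z) ∪ sS Γ U Z ω) ω') * ind (sD Γ (U \ Z) x ((N \ ↑Z) ∪ sS Γ U Z ω)) ω') := by
  set Φ : Set V → Set V → ℝ := fun ζ η =>
    G (srest Γ (U \ Z) ((N \ ↑Z) ∪ sS Γ U Z ζ) η) * ind (sD Γ (U \ Z) x ((N \ ↑Z) ∪ sS Γ U Z ζ)) η with hΦ
  have hind : ∀ (M : Set V) (η : Set V), ind (sD Γ (U \ Z) x M) (η \ ↑Z) = ind (sD Γ (U \ Z) x M) η := by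
    intro M η
    by_cases h : η ∈ sD Γ (U \ Z) x M
    · rw [ind_of_mem h, ind_of_mem ((mem_sD_diff U Z x M η).2 h)]
    · rw [ind_of_not_mem h, ind_of_not_mem fun h' => h ((mem_sD_diff U Z x M η).1 h')]
  have hind' : ∀ ω : Set V, ind (sD Γ U x N) ω = ind (sD Γ (U \ Z) x ((N \ ↑Z) ∪ sS Γ U Z ω)) ω := by
    intro ω
    by_cases h : ω ∈ sD Γ U x N
    · rw [ind_of_mem h, ind_of_mem ((mem_sD_iff_restrict hZU hx hZN ω).1 h)]
    · rw [ind_of_not_mem h, ind_of_not_mem fun h' => h ((mem_sD_iff_restrict hZU hx hZN ω).2 h')]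
  have h1 : ∀ ω, G (srest Γ U N ω) * ind (sD Γ U x N) ω = Φ (ω ∩ ↑Z) (ω \ ↑Z) := by
    intro ω
    simp only [hΦ, sS_inter, srest_diff, hind, ← srest_restrict hZU hZN, hind']
  have h2 : ∀ ω ω', Φ (ω ∩ ↑Z) (ω' \ ↑Z) =
      G (srest Γ (U \ Z) ((N \ ↑Z) ∪ sS Γ U Z ω) ω') * ind (sD Γ (U \ Z) x ((N \ ↑Z) ∪ sS Γ U Z ω)) ω' := by
    intro ω ω'
    simp only [hΦ, sS_inter, srest_diff, hind]
  calc ∑ ω, weight q ω * (G (srest Γ U N ω) * ind (sD Γ U x N) ω)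
      = (∑ ω, weight q ω) * ∑ ω, weight q ω * Φ (ω ∩ ↑Z) (ω \ ↑Z) := by
        rw [hm, one_mul]; simp_rw [h1]
    _ = ∑ ω, weight q ω * ∑ ω', weight q ω' * Φ (ω ∩ ↑Z) (ω' \ ↑Z) := blockFubini q (↑Z : Set V) Φ
    _ = _ := by simp_rw [h2]

end SiteBHK

end Summit.CriticalPhenomena.PercolationContinuityZ3.Theorems.Transplant
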